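import Mathlib
import Summits.NavierStokesRegularity.NavierStokesRegularity.Theorems.EulerZoomLiouvillePowerGaugeEulerLiouvilleDSSEndpointDecayTools
import Summits.NavierStokesRegularity.NavierStokesRegularity.Theorems.EulerZoomLiouvillePowerGaugeEulerLiouvilleSelfSimilarEndpointSobolevGrowth
import Summits.NavierStokesRegularity.NavierStokesRegularity.Theorems.EulerZoomLiouvillePowerGaugeEulerLiouvilleSelfSimilarEndpointSobolevShell
import HarnessLib

/-!
# Rung C2 of the crux `EulerZoomLiouville.PowerGaugeEulerLiouville` at the endpoint `ρ = 1/2`: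
# the one-slice flux bound with the Sobolev norm of the slice in place of a pointwise growth bound

Route №10 `EulerZoomLiouville` (NavierStokesRegularity), crux E = stmt-NavierStokesRegularity-19832,
stub `stub_nonSelfSimilarRest` (DSS endpoint stratum `IsDSSPowerSpread`).  The tree's one-slice flux bound
`exists_shell_flux_consts` (`…DSSEndpointDecayTools`) reads, under the pointwise bound
`‖V(y)‖ ≤ C_up|y|^{1−δ}`: `∫_{M≤|y|≤2M} (‖V‖³ + 2|P|‖V‖) ≤ a M^{1−δ} e_T + b M^{−3/2} ‖V‖₂² √e_T`,
`e_T = ∫_{T_M}‖V‖²`, `T_M = {M/8 ≤ |y| < 32M}`.  Here the pointwise bound is replaced by a WEAK GRADIENT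
`G` of the slice with `∫_{B_{32M}} |G|²_F ≤ g`:

* `EndpointSobolev.rpow_threeHalves_add_le` — `(x + y)^{3/2} ≤ 2^{3/2} (x^{3/2} + y^{3/2})`;
* `EndpointSobolev.exists_slice_flux_consts_of_weakGradient` — there are absolute `a, b ≥ 0` (given a
  Stein constant) with, for `M ≥ 1` and the Riesz representation of `P` below `|y| < 16M`,
  `∫_{M≤|y|≤2M} (‖V‖³ + 2|P|‖V‖) ≤ a ((∫‖V‖²)^{3/4} + g^{3/4}) e_T^{3/4} + b M^{−3/2} (∫‖V‖²) √e_T`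
  (scale-invariant Sobolev `∫_{B_{32M}}‖V‖⁶ ≤ (C((32M)⁻¹√(∫‖V‖²) + √g))⁶`, `…SobolevTools`; cubic and
  mid-pressure terms by the Cauchy–Schwarz interpolations and `shell_pressure_le_of_memLp_four`,
  `…SobolevShell`; far sources as in the tree).

Integrated over a DSS period with Hölder in time (only `∫ g dτ` is controlled, by the `E`-gauge) this
gives the window-sum power `1/4` of the growth-free DSS recursion (`…DSSEndpointSobolevPeriodFlux`).

WHAT THIS IS NOT: not NS, not E, not the stub — the one-slice input of the growth-free DSS endpoint drain.
[cite: ChaeShvydkoy2013, §3.1 proof of Thm. 3.1]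
-/

noncomputable section

-- flat `Theorems/<Route><Decl>…` files of one crux share the namespace of the crux (tree convention)
set_option linter.dupNamespace false

open MeasureTheory Set Filter Topology Metric Function TopologicalSpace
open scoped ENNReal NNReal InnerProductSpace RealInnerProductSpace

namespace Summit.NavierStokesRegularity.NavierStokesRegularity.Theorems.PowerGaugeEulerLiouville

open Literature.Analysis Literature.Analysis.FunctionSpaces Literature.Analysis.FluidPDE

namespace EndpointSobolev

section Arith

/-- `(x + y)^{3/2} ≤ 2^{3/2} (x^{3/2} + y^{3/2})` for `x, y ≥ 0` (via `x + y ≤ 2 max x y`). [folklore] -/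
theorem rpow_threeHalves_add_le {x y : ℝ} (hx : 0 ≤ x) (hy : 0 ≤ y) :
    (x + y) ^ (3 / 2 : ℝ) ≤ (2 : ℝ) ^ (3 / 2 : ℝ) * (x ^ (3 / 2 : ℝ) + y ^ (3 / 2 : ℝ)) := by
  have hmax0 : 0 ≤ max x y := le_max_of_le_left hx
  have h1 : x + y ≤ 2 * max x y := by
    rcases le_total x y with h | h
    · rw [max_eq_right h]; linarith
    · rw [max_eq_left h]; linarith
  have h2 : (x + y) ^ (3 / 2 : ℝ) ≤ (2 * max x y) ^ (3 / 2 : ℝ) :=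
    Real.rpow_le_rpow (add_nonneg hx hy) h1 (by norm_num)
  have h3 : (max x y) ^ (3 / 2 : ℝ) ≤ x ^ (3 / 2 : ℝ) + y ^ (3 / 2 : ℝ) := by
    rcases le_total x y with h | h
    · rw [max_eq_right h]; exact le_add_of_nonneg_left (Real.rpow_nonneg hx _)
    · rw [max_eq_left h]; exact le_add_of_nonneg_right (Real.rpow_nonneg hy _)
  calc (x + y) ^ (3 / 2 : ℝ) ≤ (2 * max x y) ^ (3 / 2 : ℝ) := h2
    _ = (2 : ℝ) ^ (3 / 2 : ℝ) * (max x y) ^ (3 / 2 : ℝ) := Real.mul_rpow (by norm_num) hmax0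
    _ ≤ (2 : ℝ) ^ (3 / 2 : ℝ) * (x ^ (3 / 2 : ℝ) + y ^ (3 / 2 : ℝ)) :=
        mul_le_mul_of_nonneg_left h3 (by positivity)

end Arith

section SliceFlux

set_option maxHeartbeats 400000 in
/-- **One-slice cubic and pressure flux, Sobolev form.**  Given a Stein constant `C_S` there are
`a, b ≥ 0` such that: for a velocity slice `V ∈ L² ∩ L³_loc` with `|P|‖V‖ ∈ L¹_loc`, a weak gradient `G`
of `V` on `ℝ³` with `∫_{B_{32M}} |G|²_F ≤ g` (`M ≥ 1`, `g ≥ 0`), and the Riesz representation of `P` below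
`|y| < 16M` at source scale `32M`,
`∫_{M ≤ |y| ≤ 2M} (‖V‖³ + 2|P|‖V‖) ≤ a ((∫‖V‖²)^{3/4} + g^{3/4}) (∫_{T_M}‖V‖²)^{3/4} + b M^{−3/2} (∫‖V‖²) √(∫_{T_M}‖V‖²)`,
`T_M = {M/8 ≤ |y| < 32M}` — the tree's `exists_shell_flux_consts` with the pointwise growth bound replaced
by the weak gradient (Sobolev `W^{1,2}(B_{32M}) ⊂ L⁶`, two Cauchy–Schwarz steps, mid Riesz source in
`L⁴`). [cite: ChaeShvydkoy2013, §3.1 proof of Thm. 3.1] -/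
theorem exists_slice_flux_consts_of_weakGradient (C_S : ℝ≥0) :
    ∃ a b : ℝ, 0 ≤ a ∧ 0 ≤ b ∧
      ∀ (V : EuclideanSpace ℝ (Fin 3) → EuclideanSpace ℝ (Fin 3)) (P : EuclideanSpace ℝ (Fin 3) → ℝ)
        (G : EuclideanSpace ℝ (Fin 3) → EuclideanSpace ℝ (Fin 3) →L[ℝ] EuclideanSpace ℝ (Fin 3)),
        (∀ w : EuclideanSpace ℝ (Fin 3) → EuclideanSpace ℝ (Fin 3), MemLp w 3 volume →
          MemLp w 4 volume → eLpNorm (rieszPressure w) 2 volume ≤ C_S * eLpNorm w 4 volume ^ 2) →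
        AEStronglyMeasurable V volume → Integrable (fun z => ‖V z‖ ^ 2) volume →
        LocallyIntegrable (fun y => ‖V y‖ ^ 3) volume →
        LocallyIntegrable (fun y => |P y| * ‖V y‖) volume →
        HasWeakFDerivOn (⊤ : Opens (EuclideanSpace ℝ (Fin 3))) volume V G →
        AEStronglyMeasurable G volume →
        ∀ {M g : ℝ}, 1 ≤ M → 0 ≤ g →
        (∫⁻ y in ball (0 : EuclideanSpace ℝ (Fin 3)) (32 * M), ENNReal.ofReal (frobeniusNormSq (G y))) ≤
            ENNReal.ofReal g →
        (∀ᵐ y ∂volume, ‖y‖ < 16 * M →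
          P y = rieszPressure ((ball (0 : EuclideanSpace ℝ (Fin 3)) (32 * M)).indicator V) y +
            ∫ z in {z | 32 * M ≤ ‖z‖}, pressureKernel (y - z) (V z)) →
        ∫ y in {y | M ≤ ‖y‖ ∧ ‖y‖ ≤ 2 * M}, (‖V y‖ ^ 3 + 2 * (|P y| * ‖V y‖)) ≤
          a * ((∫ z, ‖V z‖ ^ 2) ^ (3 / 4 : ℝ) + g ^ (3 / 4 : ℝ)) *
              (∫ y in {y | M / 8 ≤ ‖y‖ ∧ ‖y‖ < 32 * M}, ‖V y‖ ^ 2) ^ (3 / 4 : ℝ) +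
            b * M ^ (-(3 / 2 : ℝ)) * (∫ z, ‖V z‖ ^ 2) *
              Real.sqrt (∫ y in {y | M / 8 ≤ ‖y‖ ∧ ‖y‖ < 32 * M}, ‖V y‖ ^ 2) := by
  -- adapted from `exists_shell_flux_consts` (…DSSEndpointDecayTools)
  obtain ⟨C₆, hC₆0, hSob⟩ := exists_sobolev_six_ball
  set v₁ : ℝ := volume.real (ball (0 : EuclideanSpace ℝ (Fin 3)) 1) with hv₁
  have hv₁0 : 0 ≤ v₁ := measureReal_nonneg
  set A₀ : ℝ := (C₆ ^ 6) ^ (1 / 4 : ℝ) * (2 : ℝ) ^ (3 / 2 : ℝ) with hA₀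
  have hA₀0 : 0 ≤ A₀ := by positivity
  refine ⟨A₀ * (1 + 2 * C_S), 4 * (512 * Real.sqrt (512 * v₁) / (2 * Real.pi)), by positivity,
    by positivity, ?_⟩
  intro V P G hCS hVm hV2 hV3 hPV hW hGm M g hM hg hGB hP
  have hM0 : 0 < M := one_pos.trans_le hM
  set S : Set (EuclideanSpace ℝ (Fin 3)) := {y | M / 4 ≤ ‖y‖ ∧ ‖y‖ ≤ 8 * M} with hS
  set T : Set (EuclideanSpace ℝ (Fin 3)) := {y | M / 8 ≤ ‖y‖ ∧ ‖y‖ < 32 * M} with hT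
  set B : Set (EuclideanSpace ℝ (Fin 3)) := ball 0 (32 * M) with hBdef
  have hSm : MeasurableSet S := (measurableSet_le measurable_const measurable_norm).inter
    (measurableSet_le measurable_norm measurable_const)
  have hTm : MeasurableSet T := (measurableSet_le measurable_const measurable_norm).inter
    (measurableSet_lt measurable_norm measurable_const)
  have hST : S ⊆ T := fun y hy => ⟨by linarith [hy.1], by linarith [hy.2]⟩
  have hSB : S ⊆ B := fun y hy => by rw [hBdef, mem_ball, dist_zero_right]; linarith [hy.2]
  have hTB : T ⊆ B := fun y hy => by rw [hBdef, mem_ball, dist_zero_right]; exact hy.2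
  have hS8 : S ⊆ closedBall (0 : EuclideanSpace ℝ (Fin 3)) (8 * M) := fun y hy => by
    rw [mem_closedBall, dist_zero_right]; exact hy.2
  set eS : ℝ := ∫ y in S, ‖V y‖ ^ 2 with heS
  set eT : ℝ := ∫ y in T, ‖V y‖ ^ 2 with heT
  set E₂ : ℝ := ∫ z, ‖V z‖ ^ 2 with hE₂
  have heS0 : 0 ≤ eS := setIntegral_nonneg hSm fun y _ => by positivity
  have hE₂0 : 0 ≤ E₂ := integral_nonneg fun z => by positivity
  have heST : eS ≤ eT :=
    setIntegral_mono_set hV2.integrableOn (Eventually.of_forall fun y => by positivity)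
      hST.eventuallyLE
  have heT0 : 0 ≤ eT := heS0.trans heST
  -- Sobolev on `B_{32M}`
  obtain ⟨hI6B, hq⟩ := hSob V G hW hVm hGm hV2 (32 * M) g (by positivity) hg hGB
  set q : ℝ := ∫ y in B, ‖V y‖ ^ 6 with hqdef
  have hq0 : 0 ≤ q := setIntegral_nonneg measurableSet_ball fun y _ => by positivity
  -- `q^{1/4} ≤ A₀ (E₂^{3/4} + g^{3/4})`
  have hq4 : q ^ (1 / 4 : ℝ) ≤ A₀ * (E₂ ^ (3 / 4 : ℝ) + g ^ (3 / 4 : ℝ)) := by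
    have hb0 : 0 ≤ (32 * M)⁻¹ * Real.sqrt E₂ + Real.sqrt g := by positivity
    have hb1 : (32 * M)⁻¹ * Real.sqrt E₂ + Real.sqrt g ≤ Real.sqrt E₂ + Real.sqrt g := by
      have h1 : (32 * M)⁻¹ ≤ 1 := inv_le_one_of_one_le₀ (by linarith)
      have := mul_le_mul_of_nonneg_right h1 (Real.sqrt_nonneg E₂)
      linarith
    have h1 : q ≤ (C₆ * (Real.sqrt E₂ + Real.sqrt g)) ^ 6 :=
      hq.trans (pow_le_pow_left₀ (by positivity) (mul_le_mul_of_nonneg_left hb1 hC₆0) 6)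
    have h2 : q ^ (1 / 4 : ℝ) ≤ ((C₆ * (Real.sqrt E₂ + Real.sqrt g)) ^ 6) ^ (1 / 4 : ℝ) :=
      Real.rpow_le_rpow hq0 h1 (by norm_num)
    have h3 : ((C₆ * (Real.sqrt E₂ + Real.sqrt g)) ^ 6) ^ (1 / 4 : ℝ) =
        (C₆ ^ 6) ^ (1 / 4 : ℝ) * (Real.sqrt E₂ + Real.sqrt g) ^ (3 / 2 : ℝ) := by
      rw [mul_pow, Real.mul_rpow (by positivity) (by positivity),
        ← Real.rpow_natCast (Real.sqrt E₂ + Real.sqrt g) 6, ← Real.rpow_mul (by positivity)]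
      norm_num
    have h4 := rpow_threeHalves_add_le (Real.sqrt_nonneg E₂) (Real.sqrt_nonneg g)
    have e1 : Real.sqrt E₂ ^ (3 / 2 : ℝ) = E₂ ^ (3 / 4 : ℝ) := by
      rw [Real.sqrt_eq_rpow, ← Real.rpow_mul hE₂0]; norm_num
    have e2 : Real.sqrt g ^ (3 / 2 : ℝ) = g ^ (3 / 4 : ℝ) := by
      rw [Real.sqrt_eq_rpow, ← Real.rpow_mul hg]; norm_num
    rw [e1, e2] at h4
    calc q ^ (1 / 4 : ℝ) ≤ (C₆ ^ 6) ^ (1 / 4 : ℝ) * (Real.sqrt E₂ + Real.sqrt g) ^ (3 / 2 : ℝ) := by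
          rw [← h3]; exact h2
      _ ≤ (C₆ ^ 6) ^ (1 / 4 : ℝ) * ((2 : ℝ) ^ (3 / 2 : ℝ) * (E₂ ^ (3 / 4 : ℝ) + g ^ (3 / 4 : ℝ))) :=
          mul_le_mul_of_nonneg_left h4 (by positivity)
      _ = A₀ * (E₂ ^ (3 / 4 : ℝ) + g ^ (3 / 4 : ℝ)) := by rw [hA₀]; ring
  -- `‖V‖⁶ ∈ L¹` on `S`, `T`
  have hI6S : IntegrableOn (fun y => ‖V y‖ ^ 6) S volume := hI6B.mono_set hSB
  have hI6T : IntegrableOn (fun y => ‖V y‖ ^ 6) T volume := hI6B.mono_set hTB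
  have h6S : ∫ y in S, ‖V y‖ ^ 6 ≤ q :=
    setIntegral_mono_set hI6B (Eventually.of_forall fun y => by positivity) hSB.eventuallyLE
  have h6T : ∫ y in T, ‖V y‖ ^ 6 ≤ q :=
    setIntegral_mono_set hI6B (Eventually.of_forall fun y => by positivity) hTB.eventuallyLE
  have h6S0 : 0 ≤ ∫ y in S, ‖V y‖ ^ 6 := setIntegral_nonneg hSm fun y _ => by positivity
  have h6T0 : 0 ≤ ∫ y in T, ‖V y‖ ^ 6 := setIntegral_nonneg hTm fun y _ => by positivity
  -- cubic: `∫_S ‖V‖³ ≤ q^{1/4} eT^{3/4}`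
  have hcub : ∫ y in S, ‖V y‖ ^ 3 ≤ q ^ (1 / 4 : ℝ) * eT ^ (3 / 4 : ℝ) := by
    have h := setIntegral_norm_pow_three_le hVm hV2.integrableOn hI6S
    calc ∫ y in S, ‖V y‖ ^ 3 ≤ (∫ y in S, ‖V y‖ ^ 6) ^ (1 / 4 : ℝ) * eS ^ (3 / 4 : ℝ) := h
      _ ≤ q ^ (1 / 4 : ℝ) * eT ^ (3 / 4 : ℝ) := by gcongr
  -- pressure: mid source in `L⁴`
  have h4T : IntegrableOn (fun y => ‖V y‖ ^ 4) T volume := integrableOn_norm_pow_four hVm hV2.integrableOn hI6T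
  have hmid4 : MemLp (T.indicator V) 4 volume := memLp_indicator_four_of_integrableOn hVm hTm h4T
  have hpre := shell_pressure_le_of_memLp_four hCS hVm hV2 hV3 hPV hM0 hmid4 hP
  have h4sqrt : Real.sqrt (∫ y in T, ‖V y‖ ^ 4) * Real.sqrt eS ≤ q ^ (1 / 4 : ℝ) * eT ^ (3 / 4 : ℝ) := by
    have h4le := setIntegral_norm_pow_four_le hVm hV2.integrableOn hI6T
    have step1 : Real.sqrt (∫ y in T, ‖V y‖ ^ 4) ≤ Real.sqrt (Real.sqrt q * Real.sqrt eT) := by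
      refine Real.sqrt_le_sqrt (h4le.trans ?_)
      gcongr
    have step2 : Real.sqrt (Real.sqrt q * Real.sqrt eT) * Real.sqrt eT = q ^ (1 / 4 : ℝ) * eT ^ (3 / 4 : ℝ) := by
      rw [Real.sqrt_eq_rpow, Real.sqrt_eq_rpow, Real.sqrt_eq_rpow,
        Real.mul_rpow (Real.rpow_nonneg hq0 _) (Real.rpow_nonneg heT0 _),
        ← Real.rpow_mul hq0, ← Real.rpow_mul heT0, mul_assoc, ← Real.rpow_add' heT0 (by norm_num)]
      norm_num
    calc Real.sqrt (∫ y in T, ‖V y‖ ^ 4) * Real.sqrt eS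
        ≤ Real.sqrt (Real.sqrt q * Real.sqrt eT) * Real.sqrt eT :=
          mul_le_mul step1 (Real.sqrt_le_sqrt heST) (Real.sqrt_nonneg _) (Real.sqrt_nonneg _)
      _ = q ^ (1 / 4 : ℝ) * eT ^ (3 / 4 : ℝ) := step2
  have hvol : volume.real (closedBall (0 : EuclideanSpace ℝ (Fin 3)) (8 * M)) = (8 * M) ^ 3 * v₁ := by
    rw [Measure.addHaar_real_closedBall _ _ (by positivity), finrank_euclideanSpace_fin]
  rw [hvol] at hpre
  -- pass to the larger shell `S` and split the integral
  have hint3 : IntegrableOn (fun y => ‖V y‖ ^ 3) S volume :=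
    (hV3.integrableOn_isCompact (isCompact_closedBall 0 (8 * M))).mono_set hS8
  have hintPV : IntegrableOn (fun y => |P y| * ‖V y‖) S volume :=
    (hPV.integrableOn_isCompact (isCompact_closedBall 0 (8 * M))).mono_set hS8
  have hsmall : ∫ y in {y | M ≤ ‖y‖ ∧ ‖y‖ ≤ 2 * M}, (‖V y‖ ^ 3 + 2 * (|P y| * ‖V y‖)) ≤
      ∫ y in S, (‖V y‖ ^ 3 + 2 * (|P y| * ‖V y‖)) :=
    setIntegral_mono_set (hint3.add (hintPV.const_mul 2))
      (Eventually.of_forall fun y => by positivity)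
      (Eventually.of_forall fun y hy => ⟨by linarith [hy.1], by linarith [hy.2]⟩)
  refine hsmall.trans ?_
  rw [integral_add hint3 (hintPV.const_mul 2), integral_const_mul]
  -- scaling of the far constant
  have hfar : 1 / (2 * Real.pi * (M / 8) ^ 3) * Real.sqrt ((8 * M) ^ 3 * v₁) =
      512 * Real.sqrt (512 * v₁) / (2 * Real.pi) * M ^ (-(3 / 2 : ℝ)) := by
    have h := farField_scaling hM0 hv₁0
    rw [div_eq_iff hM0.ne'] at h
    rw [h, mul_assoc, ← Real.rpow_add_one hM0.ne']
    norm_num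
  have hN : E₂ / (2 * Real.pi * (M / 8) ^ 3) * Real.sqrt ((8 * M) ^ 3 * v₁) =
      E₂ * (512 * Real.sqrt (512 * v₁) / (2 * Real.pi) * M ^ (-(3 / 2 : ℝ))) := by
    rw [← hfar]; ring
  have hq4' : q ^ (1 / 4 : ℝ) * eT ^ (3 / 4 : ℝ) ≤
      A₀ * (E₂ ^ (3 / 4 : ℝ) + g ^ (3 / 4 : ℝ)) * eT ^ (3 / 4 : ℝ) :=
    mul_le_mul_of_nonneg_right hq4 (Real.rpow_nonneg heT0 _)
  calc (∫ y in S, ‖V y‖ ^ 3) + 2 * ∫ y in S, |P y| * ‖V y‖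
      ≤ q ^ (1 / 4 : ℝ) * eT ^ (3 / 4 : ℝ) + 2 * (C_S * Real.sqrt (∫ y in T, ‖V y‖ ^ 4) * Real.sqrt eS +
          2 * (E₂ / (2 * Real.pi * (M / 8) ^ 3)) * Real.sqrt ((8 * M) ^ 3 * v₁) * Real.sqrt eS) :=
        add_le_add hcub (mul_le_mul_of_nonneg_left hpre (by norm_num))
    _ ≤ q ^ (1 / 4 : ℝ) * eT ^ (3 / 4 : ℝ) + 2 * (C_S * (q ^ (1 / 4 : ℝ) * eT ^ (3 / 4 : ℝ)) +
          2 * (E₂ / (2 * Real.pi * (M / 8) ^ 3)) * Real.sqrt ((8 * M) ^ 3 * v₁) * Real.sqrt eT) := by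
        have h1 : (C_S : ℝ) * Real.sqrt (∫ y in T, ‖V y‖ ^ 4) * Real.sqrt eS ≤
            C_S * (q ^ (1 / 4 : ℝ) * eT ^ (3 / 4 : ℝ)) := by
          rw [mul_assoc]; exact mul_le_mul_of_nonneg_left h4sqrt C_S.coe_nonneg
        gcongr
    _ ≤ A₀ * (E₂ ^ (3 / 4 : ℝ) + g ^ (3 / 4 : ℝ)) * eT ^ (3 / 4 : ℝ) +
          2 * (C_S * (A₀ * (E₂ ^ (3 / 4 : ℝ) + g ^ (3 / 4 : ℝ)) * eT ^ (3 / 4 : ℝ)) +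
          2 * (E₂ / (2 * Real.pi * (M / 8) ^ 3)) * Real.sqrt ((8 * M) ^ 3 * v₁) * Real.sqrt eT) := by
        gcongr
    _ = A₀ * (1 + 2 * C_S) * (E₂ ^ (3 / 4 : ℝ) + g ^ (3 / 4 : ℝ)) * eT ^ (3 / 4 : ℝ) +
          4 * (512 * Real.sqrt (512 * v₁) / (2 * Real.pi)) * M ^ (-(3 / 2 : ℝ)) * E₂ *
            Real.sqrt eT := by
        have : 2 * (E₂ / (2 * Real.pi * (M / 8) ^ 3)) * Real.sqrt ((8 * M) ^ 3 * v₁) =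
            2 * (E₂ / (2 * Real.pi * (M / 8) ^ 3) * Real.sqrt ((8 * M) ^ 3 * v₁)) := by ring
        rw [this, hN]
        ring

end SliceFlux

end EndpointSobolev

end Summit.NavierStokesRegularity.NavierStokesRegularity.Theorems.PowerGaugeEulerLiouville
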